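import Summits.CriticalPhenomena.PercolationContinuityZ3.Theorems.Transplant.SkelFrm1ReachRowsQD
import Summits.CriticalPhenomena.PercolationContinuityZ3.Theorems.Transplant.SkelPhiCorridorKGRoomsQYU
import Summits.CriticalPhenomena.PercolationContinuityZ3.Theorems.Transplant.SkelFrmBChoiceDefs3
import Summits.CriticalPhenomena.PercolationContinuityZ3.Theorems.Transplant.SkelFrmBChoiceGeom
import Summits.CriticalPhenomena.PercolationContinuityZ3.Theorems.Transplant.SkelFrmBChoiceLinks
import Summits.CriticalPhenomena.PercolationContinuityZ3.Theorems.Transplant.SkelFrmBChoiceKit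
import Summits.CriticalPhenomena.PercolationContinuityZ3.Theorems.Transplant.SkelFrmBChoiceZone
import Summits.CriticalPhenomena.PercolationContinuityZ3.Theorems.Transplant.SkelFrmBChoiceRooms
import Summits.CriticalPhenomena.PercolationContinuityZ3.Theorems.Transplant.SkelFrmBChoiceNums
import Summits.CriticalPhenomena.PercolationContinuityZ3.Theorems.Transplant.SkelFrmBParamsSchedA
import Summits.CriticalPhenomena.PercolationContinuityZ3.Theorems.Transplant.SkelFrmBParamsCorrKG
import HarnessLib

/-!
(J17 / (R-39): the UNION-PRISM twin of the second-axis half of SkelFrm1ReachRowsQD — `reachOblAtHNF_frmQ3D_sndU` over `reachOblAtHNF_of_kgCorrYSU`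
(schedule `kgCorrSchedYU`, PER-REGION reading rows `hPR`); text otherwise verbatim.)
# N2 (frames-only node `SamePDropOfSkeletonFrm₁`, OPEN), (C) column: THE CORRIDOR RESIDUE OF THE CHOICE FUNCTION OF RECORD AT ONE PROBE, FIRST AXIS,
# EVERY STRUCTURAL BINDER DISCHARGED, ENTRANCE DEPTH A HYPOTHESIS (J15) — `PlanarSkeletonFrm.NegB.reachOblAtHNF_frmQ3D_fst/_snd`

`Skelφ.reachOblAtHNF_of_kgCorrSD/YSD` (SkelPhiCorridorKGRoomsQD/QYD, the J15 twins with the entrance depth `hdeep` a hypothesis) instantiated at the scheme of record `⟨ΓQ κ Φ t p O gv fv Sv cv bv q, q, κ.δ⟩` of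
`NegB.choiceAtQ3` (SkelFrmBChoiceDefs3) under `AtQNQ O q`, onward direction `((0 : Fin 2), true)`: the fine map `fineOA` (= `fineSkel` at the lattice record
`prFA`, by `rfl`), its Lipschitz/weak-step facts, the Γ package (`geom_fineA_at_bS`), the long frame `φL` (`lip_φL/steps_φL`, `|h_L| ≤ 10 n_L` from
`clauseL_of_atQ`), the column origin `colVS (tgt e)` (`colVS_eq`, `colVS_mem_graphBall_lin`), the (S0) kit block `KS0.kit0` with ALL its constant rows
(`kit0_ok/kit0_sizes/hr₀_kit0/hreach_kit0`, `r₀ := r₀0 … Rl`), the short region `KS.RgK` (`RgK_subset_graphBall`, `card_RgK_le`), the zone datum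
`Λ c M_u` (`hΛRg_of_atQ`, `hzconn_of_atQ`, `c ∈ Λ c M_u`), the kit levels/counts at the flat root accuracy `κ.δr 0` (`KS0.j₀0/j₁0/Rlev0/R'0`, `hNk0_at`,
`counts_atq_root`), and the long links in their literal shape (`hlong_of_atQ3/hlongY_of_atQ3`, p3-g16) are ALL DISCHARGED here; the corridor enters through
`ParkOK` of the two parking records at `R′ := KS0.R'0`, `ρ := 0` (J14a; stmt-g20's `kgRows0_of….kgVals_ok₁/ok₂/split`), and what stays a hypothesis is
NUMERIC ONLY plus the entrance depth — the radius rows of the schedule `schedOfS … (Sv … q)`, the reading rows of the prism box / arrival box / start box at the lattice record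
`prFA`, the depth row, the world rows of the rim-excess device, and the budget `nmax` (stmt-g20's Radii/SlotsS/CorrKG0/Len files discharge them by name).
The landed `reachOblAtHNF_frmQ3_fst/_snd` (SkelFrm1ReachRowsQ, over the landed RoomsQ/QY with `hRC/hRB`) are superseded in use (J15: their radius row set is unsatisfiable at the schedule of record).
builds on p205010 (kernel theorem, internal audit signed; external expert review pending) — nothing in this file uses p205010; nothing here is a claim
about the open node `SamePDropOfSkeletonFrm₁`.
Lane `prim-bschramm`, seat `prim-bschramm-p5` (gen 16; (C) lineage); helper file (`--supports stmt-CriticalPhenomena-4575 --as helper`).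
[cite: KozmaNitzan2024, §4 Lemma 12 (pp. 23–25), pp. 25–27, p. 30 (Step IV)] [cite: MartineauTassion2017, §4.3 Lemma 4.2]
-/

noncomputable section

open MeasureTheory ProbabilityTheory
open scoped ENNReal Classical

namespace Summit.CriticalPhenomena.PercolationContinuityZ3.Theorems.Transplant

namespace PlanarSkeletonFrm

open Literature.Probability.Percolation Literature.Probability.LatticeModels SimpleGraph GadgetSystem ProbeHistory HSiteScheme Contour KNCells
open Literature.Probability.Percolation.KozmaNitzan.Cells (oth sgOf)
open KNCells.KSchA KNLevels ChainPlanar ChainPara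
open Literature.Barriers.CriticalPhenomena (HasExponentialGrowth graphBall graphBall_mono mem_graphBall_self)
open Skel (ReachOblAtHNF excess)
open SkelI (tanOff)
open SkelConc (Consts)
open BoxProdZ2 (ConcRadiiG)
open TwoAxis.Para (modulus)
open Skelφ (oriφ trφ)
open Skelφ.StepI (DataN DataNS OutNS)

namespace NegB

open Neg

section Fst

variable {κ : Consts} {V : Type} [DecidableEq V] [Countable V] {G : SimpleGraph V} [G.LocallyFinite] {Φ : PlanarSkeletonFrm G} {t : V} {p : unitInterval}
  {hC : Φ.CylSubcritical p} {gv fv : Neg.FSlot} {Pv : PSlot} {Sv : SSlot} {cv : CSlot} {bv : BSlot} {O : OutNS V} {q : unitInterval}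

local notation "g°" => gOf κ Φ t p O gv
local notation "f°" => fOf κ Φ t p O fv
local notation "c°" => cOf κ Φ t p O gv fv cv
local notation "nL°" => nL κ Φ t p O.merged g° f°
local notation "ℓL°" => ℓL κ Φ t p O.merged g° f°
local notation "hL°" => hL κ Φ t p O.merged g° f°
local notation "vL°" => vL κ Φ t p O.merged g° f°
local notation "vβL°" => vβL κ Φ t p O.merged g° f°
local notation "φL°" => φL κ Φ t p O.D O.DT.toDataN O.ori g° f°
local notation "ψ°" => fineOA κ Φ t p O.D O.DT.toDataN O.ori g° f°
local notation "P°" => fcellsS κ Φ t p O.merged g° f° c°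
local notation "Λ°" => schedOfS κ Φ t p O.merged g° f° c° (Sv κ Φ t p O.merged g° f° q)
local notation "b°" => bOf κ Φ t p O gv fv bv
local notation "F°" => prFA κ Φ t p O.merged g° f°
local notation "S°" => (KSchA.mk (ΓQ κ Φ t p O gv fv Sv cv bv q) q κ.δ : KSchA V ℕ)
local notation "FD°" => FDQ κ Φ t p O gv fv Sv cv q
local notation "e₀" => (((0 : Fin 2), true) : MDir)

local notation "e₁" => (((1 : Fin 2), true) : MDir)

/-- **THE (C) RESIDUE OF THE CHOICE FUNCTION OF RECORD AT ONE PROBE, SECOND AXIS** (over `reachOblAtHNF_of_kgCorrYS`; the schedule's frame rows are the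
`KGYRows` fields `hn/hv/hlay`). [cite: KozmaNitzan2024, §4 Lemma 12 (pp. 23–25), p. 30 (Step IV)] -/
theorem reachOblAtHNF_frmQ3D_sndU (hAt : (choiceAtQ3 κ Φ t p Pv gv fv Sv cv bv hC).AtQNQ O q) (h1 : Φ.types = {t})
    (hp0 : 0 < (p : ℝ)) (hp1 : (p : ℝ) < 1) (mk : ℕ)
    -- the probe
    {h : ProbeHistory V} {e : Site 2 × MDir} (hV : (S°).Valid₂O G h e) (hdu : e₁ ∈ (S°).onwardO G h (tgt e)) (hne : e₁ ≠ rev e.2)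
    -- the corridor of record, second axis: the K-G row set at `R′ := KS0.R'0` and a run length `N` (stmt-g20: `kgYRows0_of …`, `N := kgNYv0 …`)
    {ρ qq W : ℕ} (HK : Skelφ.KGYRows nL° ℓL° hL° vL° (KS0.R'0 κ Φ t p O.merged mk) ρ qq W) (N : ℕ)
    -- the window radius
    {R : ℕ} (hr₀R : KS0.r₀0 t O.merged mk (RL κ Φ t p O gv fv) ≤ R)
    -- RADIUS ROWS of the schedule of record
    (hDQ : R + 1 ≤ (Λ°).rQ ((S°).aOf₁O G h e) (tgt e))
    (hDρ' : ∀ l, R + 1 ≤ (Λ°).ρ ((S°).aOf₂O G h e) (tgt e) e₁ l)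
    (hρM : ∀ l, (Λ°).ρ ((S°).aOf₂O G h e) (tgt e) e₁ l + 1 ≤ (Λ°).rM ((S°).aOf₂O G h e) (tgt e + stepVec e₁))
    -- THE ENTRANCE DEPTH (J15; the wrapper: `deep_of_run₂bOS`, `R₀ := E(nS α v)`)
    {R₀ : ℕ} (hdeep : ∀ a ∈ (S°).Vx G h, ∀ b ∈ (S°).Γ.Ewv ((S°).aOf₁O G h e) e.1 e.2 ∪ (FD°).Hfull ((S°).aOf₂O G h e) (tgt e) e₁,
      b ∉ (S°).Vx G h → G.Adj a b → a ∈ graphBall G t R₀)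
    -- PER-REGION READING ROWS of the second-axis corridor (J17; boxes e.g. `kgCorrSchedY_region_run_box/_park₁_box/_park₂_box`)
    (hPR : ∀ k ≤ (Skelφ.kgCorrSchedY HK.hn HK.hv HK.hlay (HK.kgYVals_ok₁ N) (HK.kgYVals_ok₂ N) (HK.kgYVals_split N)).N, ∃ lo hi : Site 2,
      (Skelφ.kgCorrSchedY HK.hn HK.hv HK.hlay (HK.kgYVals_ok₁ N) (HK.kgYVals_ok₂ N) (HK.kgYVals_split N)).region k ⊆ Finset.Icc lo hi ∧
      (-(5 * ((P°).r 1 : ℤ)) + 1 ≤ Skelφ.rdLo (F°).A nL° hL° vL° vβL° (F°).c₀ (F°).c₁ (F°).D lo hi 1 ∧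
        Skelφ.rdHi (F°).A nL° hL° vL° vβL° (F°).c₀ (F°).c₁ (F°).D lo hi 1 ≤ 22 * ((P°).r 1 : ℤ) - 1) ∧
      (-(2 * ((P°).r 0 : ℤ)) + 1 ≤ Skelφ.rdLo (F°).A nL° hL° vL° vβL° (F°).c₀ (F°).c₁ (F°).D lo hi 0 ∧
        Skelφ.rdHi (F°).A nL° hL° vL° vβL° (F°).c₀ (F°).c₁ (F°).D lo hi 0 ≤ 2 * ((P°).r 0 : ℤ) - 1))
    -- READING ROWS of the arrival box `[kgLastLoY, kgLastHiY]` (SkelPhiCorridorKGBoxes)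
    (hLl : 20 * ((P°).r 1 : ℤ) - b° 1 + 1 ≤ Skelφ.rdLo (F°).A nL° hL° vL° vβL° (F°).c₀ (F°).c₁ (F°).D (HK.kgLastLoY N) (HK.kgLastHiY N) 1 ∧
      5 * ((P°).r 1 : ℤ) ≤ Skelφ.rdLo (F°).A nL° hL° vL° vβL° (F°).c₀ (F°).c₁ (F°).D (HK.kgLastLoY N) (HK.kgLastHiY N) 1 ∧
      Skelφ.rdHi (F°).A nL° hL° vL° vβL° (F°).c₀ (F°).c₁ (F°).D (HK.kgLastLoY N) (HK.kgLastHiY N) 1 ≤ 20 * ((P°).r 1 : ℤ) + b° 1 - 1 ∧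
      Skelφ.rdHi (F°).A nL° hL° vL° vβL° (F°).c₀ (F°).c₁ (F°).D (HK.kgLastLoY N) (HK.kgLastHiY N) 1 ≤ 22 * ((P°).r 1 : ℤ))
    (hLt : PCells2S.cenS P° (tgt e + stepVec e₁) 0 - PCells2S.cenS P° (tgt e) 0 - b° 0 + 1 ≤ Skelφ.rdLo (F°).A nL° hL° vL° vβL° (F°).c₀ (F°).c₁ (F°).D (HK.kgLastLoY N) (HK.kgLastHiY N) 0 ∧
      Skelφ.rdHi (F°).A nL° hL° vL° vβL° (F°).c₀ (F°).c₁ (F°).D (HK.kgLastLoY N) (HK.kgLastHiY N) 0 ≤ PCells2S.cenS P° (tgt e + stepVec e₁) 0 - PCells2S.cenS P° (tgt e) 0 + b° 0 - 1 ∧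
      -(2 * ((P°).r 0 : ℤ)) ≤ Skelφ.rdLo (F°).A nL° hL° vL° vβL° (F°).c₀ (F°).c₁ (F°).D (HK.kgLastLoY N) (HK.kgLastHiY N) 0 ∧
      Skelφ.rdHi (F°).A nL° hL° vL° vβL° (F°).c₀ (F°).c₁ (F°).D (HK.kgLastLoY N) (HK.kgLastHiY N) 0 ≤ 2 * ((P°).r 0 : ℤ))
    -- START-BOX ROWS (`aW ≤ (n ± v) + W`, `bL ≤ qq`)
    {aW Bx bL : ℤ} (ha : (F°).D * ((F°).c₁ * (nL° : ℤ) * (b° 0 + 1) + (F°).c₀ * |vL°| * (b° 1 + 1)) ≤ (F°).c₀ * (F°).c₁ * (F°).A * modulus nL° hL° vL° vβL° * aW)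
    (hBx : (F°).D * ((b° 1 : ℤ) + 1) ≤ (F°).c₁ * (F°).A * Bx) (hbL : Bx / (Skelφ.shearUnit nL° hL° : ℤ) + 1 ≤ bL)
    (haW : aW ≤ ((((nL° : ℤ) + vL°).toNat + W : ℕ) : ℤ)) (haW' : aW ≤ ((((nL° : ℤ) - vL°).toNat + W : ℕ) : ℤ)) (hbq : bL ≤ qq)
    -- DEPTH ROW
    (hRD : ((cOffS κ Φ t p O.merged g° f° * (((tgt e) 0).natAbs + ((tgt e) 1).natAbs) + 1 : ℕ) : ℤ) +
      (10 + 3) * (((N : ℤ) + 1) * ((nL° * ℓL° / Skelφ.shearUnit nL° hL° + 1 : ℕ) : ℤ) +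
        Skelφ.kgZY₀ nL° vL° (KS0.R'0 κ Φ t p O.merged mk) ρ W N (Skelφ.kgM₁Y nL° vL° (KS0.R'0 κ Φ t p O.merged mk) ρ W N) (Skelφ.kgWm₂Y nL° vL° (KS0.R'0 κ Φ t p O.merged mk) ρ W N) (Skelφ.kgWp₂Y nL° vL° (KS0.R'0 κ Φ t p O.merged mk) ρ W N) (Skelφ.kgM₂Y nL° ℓL° hL° vL° (KS0.R'0 κ Φ t p O.merged mk) ρ qq W N) + Skelφ.kgZY₁ nL° ℓL° hL° (KS0.R'0 κ Φ t p O.merged mk) ρ qq N (Skelφ.kgM₁Y nL° vL° (KS0.R'0 κ Φ t p O.merged mk) ρ W N) (Skelφ.kgM₂Y nL° ℓL° hL° vL° (KS0.R'0 κ Φ t p O.merged mk) ρ qq W N)) ≤ R)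
    -- THE RIM EXCESS DEVICE: world rows, excess radius
    {φe : V → Site 2} {Rw m' m R₁ : ℕ} {ctr : Site 2}
    (hWπ : ∀ b ∈ (S°).Γ.Ewv ((S°).aOf₁O G h e) e.1 e.2 ∪ (FD°).Hfull ((S°).aOf₂O G h e) (tgt e) e₁, b ∈ graphBall G t Rw)
    (hWpl : ∀ b ∈ (S°).Γ.Ewv ((S°).aOf₁O G h e) e.1 e.2 ∪ (FD°).Hfull ((S°).aOf₂O G h e) (tgt e) e₁, φe b ∈ (box 2 m').image (fun s => s + ctr))
    (hm : 2 * m' ≤ m)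
    (hR₁ : ∀ R'', R₁ ≤ R'' → ∀ (Rw' : ℕ) (D' A' : Finset V), (∀ d ∈ D', d ∈ graphBall G t Rw') →
      (∀ d ∈ D', ∀ d' ∈ D', φe d - φe d' ∈ box 2 m) → A' ⊆ D' → (∀ a ∈ A', a ∈ graphBall G t (R₀ + 1)) →
        (bondPercolation G q).real (excess G t R'' D' A') ≤ κ.δr 0 / 2)
    (hR₁R : R₁ ≤ R - KS0.r₀0 t O.merged mk (RL κ Φ t p O gv fv))
    -- the budget
    {nmax : ℕ} (hnmax : (Skelφ.kgCorrSchedYU HK.hn HK.hv HK.hlay (HK.kgYVals_ok₁ N) (HK.kgYVals_ok₂ N) (HK.kgYVals_split N)).N ≤ nmax) :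
    ReachOblAtHNF G nmax S° FD° Φ.Δ (κ.δr 0) h e ((S°).aOf₂O G h e) e₁ := by
  -- the long clause and its numerics
  have hN := eqNumL_of_atQ hAt
  obtain ⟨hn1, hℓ1⟩ := one_le_of_eqNumL κ Φ t p O.merged g° f° hN
  have hκL := (clauseL_of_atQ hAt).2
  obtain ⟨-, hq1, hq2, -⟩ := factsNS_of_atQ hAt
  -- the frame
  have hlipφ := lip_φL κ Φ t p O.D O.DT.toDataN O.ori g° f°
  have hstep := steps_φL κ Φ t p O.D O.DT.toDataN O.ori g° f°
  -- the Γ package at the staggered cells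
  obtain ⟨-, -, -, -, -, -, hEx, hSt, hL⟩ := geom_fineA_at_bS κ Φ t p O.merged g° f° c° hlipφ hstep hN
    (schedOfS_WFS2 κ Φ t p O.merged g° f° c° (Sv κ Φ t p O.merged g° f° q)) (colQ_schedOfS κ Φ t p O.merged g° f° c° (Sv κ Φ t p O.merged g° f° q))
    (b₀ := b°) (bOf_le κ Φ t p O gv fv cv bv)
  -- the kit block
  obtain ⟨hPN, hdD, hDρ, hKCmax, hT, -⟩ := KS0.kit0_ok t O.merged mk ((Mu O.merged + 1 : ℕ) * (Skelφ.shearUnit nL° hL° : ℤ) + 1)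
    (KS0.r₀0 t O.merged mk (RL κ Φ t p O gv fv)) (kq := 10) le_rfl
  obtain ⟨hrs, hcS⟩ := KS0.kit0_sizes Φ t O.merged mk ((Mu O.merged + 1 : ℕ) * (Skelφ.shearUnit nL° hL° : ℤ) + 1) (KS0.r₀0 t O.merged mk (RL κ Φ t p O gv fv))
  obtain ⟨hr₀, hr₀1⟩ := KS0.hr₀_kit0 t O.merged mk ((Mu O.merged + 1 : ℕ) * (Skelφ.shearUnit nL° hL° : ℤ) + 1) (KS0.r₀0_ge t O.merged mk (RL κ Φ t p O gv fv)).1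
  have hreach := KS0.hreach_kit0 t O.merged mk ((Mu O.merged + 1 : ℕ) * (Skelφ.shearUnit nL° hL° : ℤ) + 1) (KS0.r₀0_ge t O.merged mk (RL κ Φ t p O gv fv)).2
  -- the counts at the flat root accuracy
  obtain ⟨hk, hcount⟩ := KS0.counts_atq_root κ Φ t p O.merged mk hp0 hp1 hq1 hq2
  -- levels
  have hE : KS0.j₁0 κ Φ t p O.merged mk +
      ((KS0.kit0 t O.merged mk ((Mu O.merged + 1 : ℕ) * (Skelφ.shearUnit nL° hL° : ℤ) + 1) (KS0.r₀0 t O.merged mk (RL κ Φ t p O gv fv))).N *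
          (tanOff (KS0.kit0 t O.merged mk ((Mu O.merged + 1 : ℕ) * (Skelφ.shearUnit nL° hL° : ℤ) + 1) (KS0.r₀0 t O.merged mk (RL κ Φ t p O gv fv))).ℓs
            (KS0.kit0 t O.merged mk ((Mu O.merged + 1 : ℕ) * (Skelφ.shearUnit nL° hL° : ℤ) + 1) (KS0.r₀0 t O.merged mk (RL κ Φ t p O gv fv))).M + 1) +
        (KS0.kit0 t O.merged mk ((Mu O.merged + 1 : ℕ) * (Skelφ.shearUnit nL° hL° : ℤ) + 1) (KS0.r₀0 t O.merged mk (RL κ Φ t p O gv fv))).N *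
          (KS0.kit0 t O.merged mk ((Mu O.merged + 1 : ℕ) * (Skelφ.shearUnit nL° hL° : ℤ) + 1) (KS0.r₀0 t O.merged mk (RL κ Φ t p O gv fv))).d +
        KS.KCmax t O.merged mk) ≤ KS0.R'0 κ Φ t p O.merged mk := by
    rw [KS0.tanOff_kit0]
    simp only [KS0.kit0]
    have h := (KS0.R'0_eq κ Φ t p O.merged mk).1
    unfold KS0.reach0 at h
    omega
  exact Skelφ.reachOblAtHNF_of_kgCorrYSU (φ := φL°) (ψ := ψ°) (P := P°) (w₀ := t) (Λ := Λ°) (b₀ := b°) (q := q) (δc := κ.δ)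
    (hψ := fineOA_eq_fineSkel) (hAp := (Aof_pos κ).1) (hmp := Skelφ.NegPrm.modulus_vβOf_pos hn1 hℓ1 _ _)
    (hc₀p := (prFA_c_pos κ Φ t p O.merged g° f°).1) (hc₁p := (prFA_c_pos κ Φ t p O.merged g° f°).2)
    (hDp := Skelφ.NegPrm.DofA_pos (Aof_pos κ).2 hn1 hℓ1 _ _)
    (hlip := lip_fineA_at κ Φ t p O.merged g° f° hlipφ hN) (hws := weakSteps_fineA_at κ Φ t p O.merged g° f° hstep hN)
    (hb := bOf_le κ Φ t p O gv fv cv bv) (hL := hL) (hSt := hSt) (hEx := hEx) (hV := hV) (hdu := hdu) (hdu' := hne)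
    (hlipφ := hlipφ) (hstep := hstep) (hΔ := Φ.degree_le) (hn := HK.hn) (hvn := HK.hv) (hlay := HK.hlay)
    (c₀ := colVS κ Φ t p O.merged g° f° c° hlipφ hstep hN (tgt e)) (kq := 10) (hκL := hκL)
    (hctr := colVS_eq κ Φ t p O.merged g° f° c° hlipφ hstep hN (tgt e))
    (hP₁ := HK.kgYVals_ok₁ N) (hP₂ := HK.kgYVals_ok₂ N) (hsplit := HK.kgYVals_split N) (r := RL κ Φ t p O gv fv) (hr := le_rfl)
    (hrR := le_trans (Nat.le_add_right _ _) ((KS0.r₀0_ge t O.merged mk (RL κ Φ t p O gv fv)).2.trans hr₀R))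
    (Pk := KS0.kit0 t O.merged mk ((Mu O.merged + 1 : ℕ) * (Skelφ.shearUnit nL° hL° : ℤ) + 1) (KS0.r₀0 t O.merged mk (RL κ Φ t p O gv fv)))
    (hPN := hPN) (hA := rfl) (hdD := hdD) (hDρ := hDρ) (hKCmax := hKCmax) (hT := hT) (hr₀ := hr₀) (hR := hr₀R) (hr₀1 := hr₀1)
    (hrs := hrs) (hcS := hcS) (hreach := hreach)
    (Rg := fun c => KS.RgK G t O.merged mk (KS.φK Φ t O.D O.DT.toDataN O.ori mk) c)
    (hRg := fun c => KS.RgK_subset_graphBall t O.merged mk _ c) (hRgcard := fun c => KS.card_RgK_le Φ t O.merged mk _ c)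
    (hcU1 := Nat.one_le_pow _ _ (Nat.succ_pos _))
    (Λc := O.merged.Λ) (kz := Mu O.merged) (hΛRg := hΛRg_of_atQ mk hAt) (hzconn := hzconn_of_atQ hAt) (hcz := hcz_of_atQ hAt)
    (hj0 := (KS0.tanOff_kit0 t O.merged mk _ _).le) (hj := (KS0.R'0_eq κ Φ t p O.merged mk).2.2) (hRl := (KS0.R'0_eq κ Φ t p O.merged mk).2.1.le)
    (hE := hE) (hδ := (κ.hδr 0).1) (hη := le_rfl) (kk := KS0.kk0 κ Φ t p O.merged mk) (hN := KS0.hNk0_at κ Φ t p O.merged mk hp0 hp1)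
    (hk := hk) (hcount := hcount)
    (hDQ := hDQ) (hDρ' := hDρ') (hρM := hρM) (hdeep := hdeep) (hPR := hPR) (hlast := fun y hy => HK.mem_Icc_of_mem_lastY N hy) (hLl := hLl) (hLt := hLt)
    (ha := ha) (hBx := hBx) (hbL := hbL) (haW := haW) (haW' := haW') (hbq := hbq)
    (hc₀ := colVS_mem_graphBall_lin κ Φ t p O.merged g° f° c° hlipφ hstep hN hκL (tgt e)) (hRD := hRD)
    (hWπ := hWπ) (hWpl := hWpl) (hm := hm) (hR₁ := hR₁) (hR₁R := hR₁R)
    (hlong := hlong_of_atQ3 hAt h1 (Neg.δkit_le_δr κ Φ (by norm_num)))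
    (hlongY := hlongY_of_atQ3 hAt h1 (Neg.δkit_le_δr κ Φ (by norm_num)))
    (hnmax := hnmax)

end Fst

end NegB

end PlanarSkeletonFrm

end Summit.CriticalPhenomena.PercolationContinuityZ3.Theorems.Transplant

end
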